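import Summits.KontsevichZagierPeriods.KontsevichZagierPeriods.Theorems.FiveTermTransfer.Negative.LoadBearing
import Literature.NumberTheory.Transcendental.KZLogCalculusProofs

/-!
# `FiveTermTransfer` (stmt-KontsevichZagierPeriods-3469) — part 4: reduction to one standard family

Positive by-products of the cdisprove seat (gen 2), information for the provers: the class map is
odd under conjugation (`signedClass_conj`), any two standard families give elements differing by a
relation (`fiveTerm_sub_fiveTerm_mem_relations`, integrand additivity with a zero representation via
the tree's `KZ.of_sub_of_mem_relations_of_eqOn`), and the crux is EQUIVALENT to its instance for the
single family `ρ₀` with only `x ≠ 0`, `y ≠ 0`, `y ≠ 1` (`fiveTermTransfer_iff_ρ₀`; the instances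
`x = 1`, `x = y` are `0`). A prover may therefore fix `ρ = KZ.idealTetrahedronRep`. [folklore]
-/

noncomputable section

open Complex MeasureTheory Set
open scoped ComplexConjugate

namespace Summit.KontsevichZagierPeriods.HyperbolicBloch.FiveTermTransferNegative

open Literature.NumberTheory.Transcendental
open Literature.NumberTheory.Transcendental.KZ
open Summit.KontsevichZagierPeriods.KontsevichZagierPeriods.Theses.HyperbolicBloch (FiveTermTransfer)

/-! ### `ρ`-independence and reduction to ONE standard family

Positive by-products (information for the provers): the class map is odd under conjugation, any
two standard families give equivalent elements, and the crux is equivalent to its instance for the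
single family `ρ₀` with the three genuinely needed side conditions `x ≠ 0`, `y ≠ 0`, `y ≠ 1`. -/

/-- `B z̄ = −B z`: the sector's relators `[w] + [w̄]` die formally under `B`. [folklore] -/
theorem signedClass_conj (ρ : ℂ → IntegralRep 3) (z : ℂ) :
    signedClass ρ (conj z) = -signedClass ρ z := by
  rcases lt_trichotomy z.im 0 with h | h | h
  · rw [signedClass_of_im_neg ρ h, signedClass_of_im_pos ρ (z := conj z) (by simpa using h),
      neg_neg]
  · rw [signedClass_of_im_zero ρ h, signedClass_of_im_zero ρ (z := conj z) (by simpa using h),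
      neg_zero]
  · rw [signedClass_of_im_pos ρ h, signedClass_of_im_neg ρ (z := conj z) (by simpa using h),
      Complex.conj_conj]

/-- Two standard families give KZ-equivalent representations at every algebraic point of the upper
half plane (integrand additivity with a zero representation: the tree's
`KZ.of_sub_of_mem_relations_of_eqOn`). So the `∀ ρ` of the crux is harmless. [folklore] -/
theorem of_sub_of_mem_relations_of_isStandardOn {ρ ρ' : ℂ → IntegralRep 3} (hρ : IsStandardOn ρ)
    (hρ' : IsStandardOn ρ') {z : ℂ} (hz : IsAlgebraic ℚ z) (him : 0 < z.im) :
    KZ.of (ρ z) - KZ.of (ρ' z) ∈ relations := by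
  obtain ⟨hd, hi⟩ := hρ z hz him
  obtain ⟨hd', hi'⟩ := hρ' z hz him
  refine of_sub_of_mem_relations_of_eqOn (hd'.trans hd.symm) ?_
  rw [hd]
  exact fun p hp => (hi hp).trans (hi' hp).symm

/-- The signed classes of two standard families differ by a relation at algebraic points. [folklore] -/
theorem signedClass_sub_mem_relations {ρ ρ' : ℂ → IntegralRep 3} (hρ : IsStandardOn ρ)
    (hρ' : IsStandardOn ρ') {z : ℂ} (hz : IsAlgebraic ℚ z) :
    signedClass ρ z - signedClass ρ' z ∈ relations := by
  rcases lt_trichotomy z.im 0 with h | h | h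
  · rw [signedClass_of_im_neg ρ h, signedClass_of_im_neg ρ' h, neg_sub_neg]
    exact of_sub_of_mem_relations_of_isStandardOn hρ' hρ
      (by simpa using hz.algHom (starRingEnd ℂ).toRatAlgHom) (by simpa using h)
  · rw [signedClass_of_im_zero ρ h, signedClass_of_im_zero ρ' h, sub_zero]
    exact zero_mem _
  · rw [signedClass_of_im_pos ρ h, signedClass_of_im_pos ρ' h]
    exact of_sub_of_mem_relations_of_isStandardOn hρ hρ' hz h

/-- The five-term elements of two standard families differ by a relation. [folklore] -/
theorem fiveTerm_sub_fiveTerm_mem_relations {ρ ρ' : ℂ → IntegralRep 3} (hρ : IsStandardOn ρ)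
    (hρ' : IsStandardOn ρ') {x y : ℂ} (hx : IsAlgebraic ℚ x) (hy : IsAlgebraic ℚ y) :
    fiveTerm (signedClass ρ) x y - fiveTerm (signedClass ρ') x y ∈ relations := by
  have h3 : IsAlgebraic ℚ (y / x) := by rw [div_eq_mul_inv]; exact hy.mul hx.inv
  have h4 : IsAlgebraic ℚ ((1 - x⁻¹) / (1 - y⁻¹)) := by
    rw [div_eq_mul_inv]; exact (isAlgebraic_one.sub hx.inv).mul (isAlgebraic_one.sub hy.inv).inv
  have h5 : IsAlgebraic ℚ ((1 - x) / (1 - y)) := by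
    rw [div_eq_mul_inv]; exact (isAlgebraic_one.sub hx).mul (isAlgebraic_one.sub hy).inv
  have e : fiveTerm (signedClass ρ) x y - fiveTerm (signedClass ρ') x y =
      (signedClass ρ x - signedClass ρ' x) - (signedClass ρ y - signedClass ρ' y)
      + (signedClass ρ (y / x) - signedClass ρ' (y / x))
      - (signedClass ρ ((1 - x⁻¹) / (1 - y⁻¹)) - signedClass ρ' ((1 - x⁻¹) / (1 - y⁻¹)))
      + (signedClass ρ ((1 - x) / (1 - y)) - signedClass ρ' ((1 - x) / (1 - y))) := by
    unfold fiveTerm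
    abel
  rw [e]
  exact add_mem (sub_mem (add_mem (sub_mem (signedClass_sub_mem_relations hρ hρ' hx)
    (signedClass_sub_mem_relations hρ hρ' hy)) (signedClass_sub_mem_relations hρ hρ' h3))
    (signedClass_sub_mem_relations hρ hρ' h4)) (signedClass_sub_mem_relations hρ hρ' h5)

/-- **Reduction to one standard family and three side conditions.** The crux is equivalent to
its instance for the single family `ρ₀` (any other standard family differs by relations), with
`x ≠ 1` and `x ≠ y` dropped (those instances are `0`). A prover may therefore fix
`ρ = KZ.idealTetrahedronRep`. [folklore] -/
theorem fiveTermTransfer_iff_ρ₀ :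
    FiveTermTransfer ↔ ∀ x y : ℂ, IsAlgebraic ℚ x → IsAlgebraic ℚ y → x ≠ 0 → y ≠ 0 → y ≠ 1 →
      fiveTerm (signedClass ρ₀) x y ∈ relations := by
  rw [fiveTermTransfer_iff]
  constructor
  · intro h x y hx hy hx0 hy0 hy1
    rcases eq_or_ne x 1 with rfl | hx1
    · rw [fiveTerm_one_left]; exact zero_mem _
    rcases eq_or_ne x y with rfl | hxy
    · rw [fiveTerm_self]; exact zero_mem _
    exact h ρ₀ isStandardOn_ρ₀ x y hx hy hx0 hx1 hy0 hy1 hxy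
  · intro h ρ hρ x y hx hy hx0 _ hy0 hy1 _
    have e : fiveTerm (signedClass ρ) x y = (fiveTerm (signedClass ρ) x y
        - fiveTerm (signedClass ρ₀) x y) + fiveTerm (signedClass ρ₀) x y := by abel
    rw [e]
    exact add_mem (fiveTerm_sub_fiveTerm_mem_relations hρ isStandardOn_ρ₀ hx hy)
      (h x y hx hy hx0 hy0 hy1)


end Summit.KontsevichZagierPeriods.HyperbolicBloch.FiveTermTransferNegative
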